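import Summits.QuantumFields.YangMills.Theses.MarkovAtoms
import HarnessLib

/-!
# Route `MarkovAtoms` — the assembly item (stmt-QuantumFields-22742), by modus ponens

`Assembly = AtomicSynthesis → MarkovHolder → AtomicMomentLaw → VarianceComparableFloors → MarkovCalibration → leaf`, and
`MarkovCalibration = AtomicSynthesis → MarkovHolder → AtomicMomentLaw → VarianceComparableFloors → leaf`; so the assembly is the
λ-term `fun hS hH hM hR hCal => hCal hS hH hM hR` (planner ym-idea-11 g7's docstring, verbatim).  Free-hands width seat `ym-t4-w11`
(cell ym-fleet).  Pure plumbing: no summit / leaf / NT / mass-gap statement is proved — the leaf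
`InfiniteVolumeContinuum.HypercubicOSDataFromInfiniteVolume` follows only from the route's open cruxes and the engine.
-/

namespace Summit.QuantumFields.YangMills.Theorems.MarkovAtoms

/-- **`MarkovAtoms.Assembly` (stmt-QuantumFields-22742)**: pure modus ponens — the engine `MarkovCalibration` already carries the
four other items to the leaf. [cite: OsterwalderSchrader1975] -/
theorem markovAtoms_assembly_proof : Summit.QuantumFields.YangMills.Theses.MarkovAtoms.Assembly :=
  fun hS hH hM hR hCal => hCal hS hH hM hR

end Summit.QuantumFields.YangMills.Theorems.MarkovAtoms
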